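import Literature.NumberTheory.GaloisRepresentations.LocalExistenceTheoremProofs
import HarnessLib

/-!
# The existence theorem from the local reciprocity law (Serre, *Local Fields*, XIII §4)

Companion to `LocalExistenceTheorem.lean` / `LocalExistenceTheoremProofs.lean` (and distinct from
`LocalReciprocity.lean`, which vendors the reciprocity map `Fˣ → Γ_F^ab` at the level of the
absolute Galois group for the Weil-group / Artin-map files).  There the
existence theorem of local class field theory, `Literature.localExistenceTheorem F` (Serre LF XIV §6
Thm. 1), was reduced to four named facts: `isNormSubgroup_inf` and `isNormSubgroup_of_le`
(Serre XI §4 Prop. 4), `index_normSubgroup_eq_finrank` (XIII §4 Prop. 9) and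
`universalNormSubgroup_divisible_and_eq` (XI §5 Prop. 6).  The first three are, in Serre's
book, immediate consequences of the **reciprocity isomorphism** `θ : Fˣ/N_{E/F}Eˣ ≅ G(E/F)`
for finite abelian `E/F` together with its functoriality.  This file

* vendors that input as ONE named fact, `Literature.localReciprocityLaw F` (XIII §4, Cor. to Prop. 8
  and the properties of the norm residue symbol `(x, E/F)` listed after Prop. 9; Prop. 12 for
  the compatibility with restriction), and
* PROVES from it the three facts above (`…_of_reciprocity`), the printed form of axiom III-3
  (`isNormSubgroup_of_unitGroup_le`, from the weak form proved in `…Proofs`), and hence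
* `Literature.NumberTheory.GaloisRepresentations.localExistenceTheorem_of_reciprocityLaw`: the existence theorem from
  `localReciprocityLaw F` and `universalNormSubgroup_divisible_and_eq F` alone.

## The statement vendored

Serre XIII §4 (pp. 196–197): for a finite Galois extension `F'/E` of local fields the cup
product with the fundamental class gives `θ_{F'/E} : G^a_{F'/E} ≅ E*/NF'*` (Cor. to Prop. 8);
its inverse `ω` is the reciprocity isomorphism and `(x, F'/E) = ω(x̄)`; for `F'/E` abelian,
`(xx', F'/E) = (x, F'/E)(x', F'/E)`, `(x, F'/E) = 1 ⟺ x ∈ NF'*`, and every `s ∈ G_{F'/E}` is an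
`(x, F'/E)`; Prop. 12: for `F'' ⊃ F' ⊃ E` Galois, the image of `(x, F''/E)` in `G_{F'/E}` is
`(x, F'/E)`.  We state this for the base `E = F` and finite abelian `E ⊆ F̄`: a family of
homomorphisms `θ_E : Fˣ →* Gal(E/F)`, surjective with kernel `N_{E/F}(Eˣ)`, compatible with
restriction `Gal(E'/F) → Gal(E/F)` for `E ≤ E'` — phrased through lifts to `Gal(F̄/F)`
(`AlgEquiv.restrictNormalHom`), which avoids an `Algebra E E'` instance.

## References

* J.-P. Serre, *Local Fields*, GTM 67, Springer 1979: Ch. XI §3 (Tate's theorem, Prop. 2),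
  §4 Prop. 3 Cor., Prop. 4; Ch. XIII §4 Thm. 1, Prop. 8 and Cor., Prop. 9, Props. 10–12
  (pp. 195–197); Ch. XIV §6 Thm. 1.  [SerreLocalFields1979]
-/

noncomputable section

open ValuativeRel

namespace Literature.NumberTheory.GaloisRepresentations

/-- **The local reciprocity law (finite abelian extensions).**  For a non-archimedean local
field `F` there is a family of homomorphisms `θ_E : Fˣ →* Gal(E/F)` (the norm residue symbols
`x ↦ (x, E/F)`), indexed by the intermediate fields `E` of `F̄/F`, such that for every finite
abelian `E`: `θ_E` is surjective, `ker θ_E = N_{E/F}(Eˣ)`, and for finite abelian `E ≤ E'` the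
symbol `(x, E/F)` is the restriction of `(x, E'/F)` — i.e. every `σ ∈ Gal(F̄/F)` restricting to
`θ_{E'} x` on `E'` restricts to `θ_E x` on `E`.  (Values of `θ` at non-abelian or infinite `E`
are unconstrained.)  Serre, *Local Fields* (1979), Ch. XIII §4: Cor. to Prop. 8
(`θ_{F/E} : G^a_{F/E} ≅ E*/NF*`), the properties of `(x, F/E)` stated after Prop. 9, and
Prop. 12 (compatibility with `F' ⊃ F ⊃ E`); proved there from Tate's theorem (XI §3) for the
class formation of XIII §4 Thm. 1.
[cite: SerreLocalFields1979, Ch. XIII §4 Cor. to Prop. 8 and Prop. 12] -/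
def localReciprocityLaw (F : Type*) [Field F] [ValuativeRel F] [TopologicalSpace F]
    [IsNonarchimedeanLocalField F] : Prop :=
  ∃ θ : (E : IntermediateField F (AlgebraicClosure F)) → (Fˣ →* (E ≃ₐ[F] E)),
    ∀ (E : IntermediateField F (AlgebraicClosure F)) [FiniteDimensional F E] [IsAbelianGalois F E],
      Function.Surjective (θ E) ∧
      (θ E).ker = (Units.map (Algebra.norm F : E →* F)).range ∧
      ∀ (E' : IntermediateField F (AlgebraicClosure F)) [FiniteDimensional F E']
        [IsAbelianGalois F E'], E ≤ E' →
        ∀ (x : Fˣ) (σ : AlgebraicClosure F ≃ₐ[F] AlgebraicClosure F),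
          AlgEquiv.restrictNormalHom E' σ = θ E' x → AlgEquiv.restrictNormalHom E σ = θ E x

/-! ### Galois-theoretic lemmas -/

section Galois

variable {K L : Type*} [Field K] [Field L] [Algebra K L]

/-- Two automorphisms of `L/K` agreeing on `E` and on `E'` agree on `E ⊔ E'`. [folklore] -/
theorem algEquiv_eqOn_sup {σ τ : L ≃ₐ[K] L} {E E' : IntermediateField K L}
    [FiniteDimensional K E] (hE : ∀ x ∈ E, σ x = τ x) (hE' : ∀ x ∈ E', σ x = τ x) :
    ∀ x ∈ E ⊔ E', σ x = τ x := by
  intro x hx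
  have hx' : x ∈ (E ⊔ E').toSubalgebra := hx
  rw [IntermediateField.sup_toSubalgebra_of_left] at hx'
  have hle : E.toSubalgebra ⊔ E'.toSubalgebra ≤ AlgHom.equalizer (σ : L →ₐ[K] L) (τ : L →ₐ[K] L) :=
    sup_le (fun y hy => (AlgHom.mem_equalizer _ _ y).mpr (hE y hy))
      (fun y hy => (AlgHom.mem_equalizer _ _ y).mpr (hE' y hy))
  exact (AlgHom.mem_equalizer _ _ x).mp (hle hx')

/-- A compositum of two finite abelian extensions (inside a normal extension `L/K`) is
abelian: `Gal(EE'/K)` embeds in `Gal(E/K) × Gal(E'/K)`. [folklore] -/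
theorem isAbelianGalois_sup [Normal K L] (E E' : IntermediateField K L) [FiniteDimensional K E]
    [IsAbelianGalois K E] [FiniteDimensional K E'] [IsAbelianGalois K E'] :
    IsAbelianGalois K (E ⊔ E' : IntermediateField K L) := by
  haveI : IsGalois K (E ⊔ E' : IntermediateField K L) :=
    isGalois_iff.mpr ⟨inferInstance, inferInstance⟩
  refine { is_comm := ⟨fun s t => ?_⟩ }
  obtain ⟨σ, rfl⟩ := AlgEquiv.restrictNormalHom_surjective (F := K) (E := L)
    (K₁ := (E ⊔ E' : IntermediateField K L)) s
  obtain ⟨τ, rfl⟩ := AlgEquiv.restrictNormalHom_surjective (F := K) (E := L)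
    (K₁ := (E ⊔ E' : IntermediateField K L)) t
  rw [← map_mul, ← map_mul]
  apply AlgEquiv.ext
  intro x
  apply Subtype.ext
  rw [AlgEquiv.restrictNormalHom_apply, AlgEquiv.restrictNormalHom_apply]
  refine algEquiv_eqOn_sup (E := E) (E' := E') (fun y hy => ?_) (fun y hy => ?_) x x.2
  · have h := IsMulCommutative.is_comm.comm (AlgEquiv.restrictNormalHom E σ)
      (AlgEquiv.restrictNormalHom E τ)
    rw [← map_mul, ← map_mul] at h
    have h' := congrArg (fun f : E ≃ₐ[K] E => ((f ⟨y, hy⟩ : E) : L)) h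
    simpa only [AlgEquiv.restrictNormalHom_apply] using h'
  · have h := IsMulCommutative.is_comm.comm (AlgEquiv.restrictNormalHom E' σ)
      (AlgEquiv.restrictNormalHom E' τ)
    rw [← map_mul, ← map_mul] at h
    have h' := congrArg (fun f : E' ≃ₐ[K] E' => ((f ⟨y, hy⟩ : E') : L)) h
    simpa only [AlgEquiv.restrictNormalHom_apply] using h'

end Galois

/-! ### Consequences of the reciprocity law (Serre XI §4 Prop. 4, Cor. to Prop. 3) -/

section Consequences

variable {F : Type*} [Field F] [ValuativeRel F] [TopologicalSpace F] [IsNonarchimedeanLocalField F]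

/-- **Norm index = degree** for finite abelian `E/F` (Serre XIII §4 Cor. to Prop. 8 / Prop. 9;
XI §4 Cor. to Prop. 3), from the reciprocity law: `Fˣ/N(Eˣ) ≅ Gal(E/F)` has order `[E:F]`.
[cite: SerreLocalFields1979, Ch. XIII §4 Prop. 9] -/
theorem index_normSubgroup_eq_finrank_of_reciprocity (h : localReciprocityLaw F) :
    index_normSubgroup_eq_finrank F := by
  intro E hfd hab
  obtain ⟨θ, hθ⟩ := h
  haveI := hfd
  haveI := hab
  obtain ⟨hsurj, hker, -⟩ := hθ E
  rw [← hker, Subgroup.index_ker, MonoidHom.range_eq_top.mpr hsurj, Subgroup.card_top,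
    IsGalois.card_aut_eq_finrank]

/-- **Norm groups are stable under intersection** (Serre XI §4 Prop. 4:
`I_{F·F'} = I_F ∩ I_{F'}`), from the reciprocity law: `N(EE') = ker θ_{EE'} = ker θ_E ∩ ker θ_{E'}`
since an automorphism is trivial on `EE'` iff it is trivial on `E` and on `E'`.
[cite: SerreLocalFields1979, Ch. XI §4 Prop. 4] -/
theorem isNormSubgroup_inf_of_reciprocity (h : localReciprocityLaw F) : isNormSubgroup_inf F := by
  rintro U V ⟨E, hE, hEab, rfl⟩ ⟨E', hE', hE'ab, rfl⟩
  obtain ⟨θ, hθ⟩ := h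
  haveI := hE; haveI := hEab; haveI := hE'; haveI := hE'ab
  haveI : IsAbelianGalois F (E ⊔ E' : IntermediateField F (AlgebraicClosure F)) :=
    isAbelianGalois_sup E E'
  obtain ⟨hsurj'', hker'', hcompat''⟩ := hθ (E ⊔ E')
  obtain ⟨-, hker, hcompat⟩ := hθ E
  obtain ⟨-, hker', hcompat'⟩ := hθ E'
  refine ⟨E ⊔ E', inferInstance, inferInstance, ?_⟩
  rw [← hker, ← hker', ← hker'']
  ext x
  simp only [MonoidHom.mem_ker, Subgroup.mem_inf]
  -- lift `θ_{EE'} x` to `σ ∈ Gal(F̄/F)`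
  obtain ⟨σ, hσ⟩ := AlgEquiv.restrictNormalHom_surjective (F := F) (E := AlgebraicClosure F)
    (K₁ := (E ⊔ E' : IntermediateField F (AlgebraicClosure F))) (θ (E ⊔ E') x)
  have hσE : AlgEquiv.restrictNormalHom E σ = θ E x := hcompat (E ⊔ E') le_sup_left x σ hσ
  have hσE' : AlgEquiv.restrictNormalHom E' σ = θ E' x := hcompat' (E ⊔ E') le_sup_right x σ hσ
  have key : ∀ (E₁ : IntermediateField F (AlgebraicClosure F)) [Normal F E₁],
      AlgEquiv.restrictNormalHom E₁ σ = 1 ↔ ∀ y ∈ E₁, σ y = y :=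
    fun E₁ _ => AlgEquiv.restrictNormal_eq_one_iff E₁ σ
  rw [← hσ, ← hσE, ← hσE', key, key, key]
  constructor
  · intro hfix
    exact ⟨fun y hy => hfix y (le_sup_left (a := E) (b := E') hy),
      fun y hy => hfix y (le_sup_right (a := E) (b := E') hy)⟩
  · rintro ⟨h1, h2⟩
    exact algEquiv_eqOn_sup (τ := 1) h1 h2

/-- **Every subgroup containing a norm group is a norm group** (Serre XI §4 Prop. 4, last
assertion), from the reciprocity law: if `N(Eˣ) ≤ V` let `H = θ_E(V) ≤ Gal(E/F)` and `E₀` its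
fixed field; then `ker θ_{E₀} = θ_E⁻¹(H) = V · ker θ_E = V`, so `V = N(E₀ˣ)`.
[cite: SerreLocalFields1979, Ch. XI §4 Prop. 4] -/
theorem isNormSubgroup_of_le_of_reciprocity (h : localReciprocityLaw F) :
    isNormSubgroup_of_le F := by
  rintro U V ⟨E, hE, hEab, rfl⟩ hUV
  obtain ⟨θ, hθ⟩ := h
  haveI := hE; haveI := hEab
  obtain ⟨hsurj, hker, hcompat⟩ := hθ E
  -- the subextension `E₀` fixed by `H = θ_E(V)`
  set H : Subgroup (E ≃ₐ[F] E) := V.map (θ E) with hH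
  set E₀ : IntermediateField F (AlgebraicClosure F) :=
    IntermediateField.lift (IntermediateField.fixedField H) with hE₀
  have hE₀E : E₀ ≤ E := IntermediateField.lift_le _
  haveI : FiniteDimensional F E₀ :=
    LinearEquiv.finiteDimensional
      (IntermediateField.liftAlgEquiv (IntermediateField.fixedField H)).toLinearEquiv
  haveI : IsAbelianGalois F E₀ := IsAbelianGalois.of_algHom (IntermediateField.inclusion hE₀E)
  obtain ⟨-, hker₀, hcompat₀⟩ := hθ E₀
  refine ⟨E₀, inferInstance, inferInstance, ?_⟩
  rw [← hker₀]
  ext x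
  -- lift `θ_E x` to `σ ∈ Gal(F̄/F)`; then `θ_{E₀} x = σ|_{E₀}`
  obtain ⟨σ, hσ⟩ := AlgEquiv.restrictNormalHom_surjective (F := F) (E := AlgebraicClosure F)
    (K₁ := E) (θ E x)
  have hσ₀ : AlgEquiv.restrictNormalHom E₀ σ = θ E₀ x := hcompat₀ E hE₀E x σ hσ
  have key : AlgEquiv.restrictNormalHom E₀ σ = 1 ↔ ∀ y ∈ E₀, σ y = y :=
    AlgEquiv.restrictNormal_eq_one_iff E₀ σ
  rw [MonoidHom.mem_ker, ← hσ₀, key]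
  -- `σ` fixes `E₀` pointwise iff `σ|_E ∈ H`
  have hfix : (∀ y ∈ E₀, σ y = y) ↔ AlgEquiv.restrictNormalHom E σ ∈ H := by
    rw [← IntermediateField.fixingSubgroup_fixedField H, IntermediateField.mem_fixingSubgroup_iff]
    constructor
    · intro hy z hz
      apply Subtype.ext
      rw [AlgEquiv.restrictNormalHom_apply]
      exact hy z ((IntermediateField.mem_lift z).mpr hz)
    · intro hz y hy
      obtain ⟨z, hz', rfl⟩ := hy
      have := hz z hz'
      rw [Subtype.ext_iff, AlgEquiv.restrictNormalHom_apply] at this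
      exact this
  rw [hfix, hσ, hH, Subgroup.mem_map]
  -- `θ_E x ∈ θ_E(V) ↔ x ∈ V` since `ker θ_E = N(Eˣ) ≤ V`
  constructor
  · rintro ⟨v, hv, hvx⟩
    have hmem : v⁻¹ * x ∈ (θ E).ker := by
      rw [MonoidHom.mem_ker, map_mul, map_inv, hvx, inv_mul_cancel]
    rw [hker] at hmem
    simpa using V.mul_mem hv (hUV hmem)
  · intro hx
    exact ⟨x, hx, rfl⟩

/-- **Axiom III-3 as printed** (Serre XIV §6, proof of Thm. 1: "these groups are norm groups
for unramified extensions"): every closed finite-index subgroup of `Fˣ` containing the units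
is a norm group — from the proved weak form `exists_isNormSubgroup_le_of_unitGroup_le` and
`isNormSubgroup_of_le` (reciprocity law).
[cite: SerreLocalFields1979, Ch. XIV §6 Thm. 1 (proof, axiom III-3)] -/
theorem isNormSubgroup_of_unitGroup_le_of_reciprocity (h : localReciprocityLaw F) :
    isNormSubgroup_of_unitGroup_le F := by
  intro U _ hUfi hOU
  obtain ⟨N, hN, hNU⟩ := exists_isNormSubgroup_le_of_unitGroup_le F U hOU
  exact isNormSubgroup_of_le_of_reciprocity h N U hN hNU

/-- **The existence theorem from the reciprocity law and Serre's Prop. 6.**  Every open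
finite-index subgroup of `Fˣ` is a norm group, given `localReciprocityLaw F` (Serre XIII §4)
and `universalNormSubgroup_divisible_and_eq F` (XI §5 Prop. 6, resting on XIV §6 III-2: the
Hilbert and Artin–Schreier symbols). [cite: SerreLocalFields1979, Ch. XIV §6 Thm. 1] -/
theorem localExistenceTheorem_of_reciprocityLaw (h : localReciprocityLaw F)
    (h₃ : universalNormSubgroup_divisible_and_eq F) : localExistenceTheorem F :=
  localExistenceTheorem_of_reciprocity F (isNormSubgroup_inf_of_reciprocity h)
    (isNormSubgroup_of_le_of_reciprocity h) h₃ (index_normSubgroup_eq_finrank_of_reciprocity h)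

/-- The trunk predicate `exists_intermediateField_normSubgroup_eq F` for a non-archimedean
local field `F`, from the reciprocity law and Serre's Prop. 6.
[cite: SerreLocalFields1979, Ch. XIV §6 Thm. 1] -/
theorem exists_intermediateField_normSubgroup_eq_of_reciprocityLaw (h : localReciprocityLaw F)
    (h₃ : universalNormSubgroup_divisible_and_eq F) :
    exists_intermediateField_normSubgroup_eq F :=
  localExistenceTheorem_of_reciprocityLaw h h₃

end Consequences

end Literature.NumberTheory.GaloisRepresentations
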